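import Mathlib.Analysis.Convex.PathConnected
import Mathlib.Analysis.Complex.Convex
import Literature.NumberTheory.LFunctions.DedekindZetaProofs
import Literature.NumberTheory.LFunctions.PrimeIdealTheoremProofs
import Literature.NumberTheory.LFunctions.DedekindZetaThetaProofs
import HarnessLib

/-!
# Non-vanishing of the continued Dedekind zeta function on `Re s ≥ 1` (Landau 1903)

Topic `Literature/NumberTheory/LFunctions`, sibling of `DedekindZeta.lean`. That file states, as the
named fact `Literature.NumberTheory.LFunctions.dedekindZetaCont_ne_zero_of_one_le_re` ([cite: LandauMathAnn1903]), that the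
continued Dedekind zeta function `Literature.dedekindZetaCont K` has no zero with `Re s ≥ 1`, `s ≠ 1`.
This file DISCHARGES it — `Literature.NumberTheory.LFunctions.dedekindZetaCont_ne_zero_of_one_le_re_holds` — together with the
residue fact `Literature.tendsto_sub_one_mul_dedekindZetaCont K` (`Literature.NumberTheory.LFunctions.tendsto_sub_one_mul_dedekindZetaCont_holds`).
Everything in this file is PROVED.

## The source

E. Landau, *Neuer Beweis des Primzahlsatzes und Beweis des Primidealsatzes*, Math. Ann. **56**
(1903), 645–670, Zweiter Teil (*Beweis des Primidealsatzes*), Einleitung, p. 666, lists the four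
properties of `ζ_κ(s)` on which the proof of the prime ideal theorem rests, each with a
footnote to its proof in Landau's Crelle paper *Ueber die zu einem algebraischen Zahlkörper
gehörige Zetafunction …*, J. reine angew. Math. **125** (l.c. pp. 81, 82, 96, 94):
"1) Wenn `k` der Grad des Körpers ist, so ist die Funktion `ζ_κ(s)` über die Gerade `ℜ(s) = 1`
hinaus mindestens bis zur Geraden `ℜ(s) = 1 − 1/k` hin fortsetzbar und ist in der Halbebene
`ℜ(s) > 1 − 1/k` eine eindeutige analytische Funktion mit dem Pole erster Ordnung `s = 1` als
einziger singulärer Stelle. 2) `ζ_κ(s)` verschwindet für kein `s` mit dem reellen Teil `1`."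
(3), 4) are growth bounds); for `ℜ(s) > 1` non-vanishing is the Euler product, ibid. (48), p. 665.
Property 2) with (48) is the vendored fact.

## Proof architecture

`Literature.dedekindZetaCont K` is `Classical.epsilon (IsDedekindZetaContinuation K)`: a function
holomorphic on `ℂ ∖ {1}` equal to the Dirichlet series `NumberField.dedekindZeta K` on `Re s > 1`,
meaningful because such a function exists — Hecke's theorem
`Literature.NumberTheory.LFunctions.NumberField.exists_isDedekindZetaContinuation_holds` (`DedekindZetaThetaProofs.lean`, Neukirch
VII (5.11)(i), proved in the tree by the theta transformation formula and the Mellin transform).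
Landau's argument is carried out in the tree on *his* continuation (property 1)): the predicate
`Literature.NumberField.IsLandauContinuation K G` (`G = (s − 1)ζ_K(s)` continued to Landau's half-plane
`σ > 1 − 1/d`, `d = [K : ℚ]`; `DedekindZetaHalfPlane.lean`), which EXISTS
(`Literature.NumberTheory.LFunctions.NumberField.exists_isLandauContinuation_holds`) and satisfies the zero-free region
`σ > 1 − c_K / log(|t| + 4)` (`Literature.NumberTheory.LFunctions.NumberField.landauContinuation_zeroFree_holds`, the
Hadamard–de la Vallée-Poussin–Landau `3 + 4cos θ + cos 2θ` method, Montgomery–Vaughan Thm. 6.6;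
both in `PrimeIdealTheoremProofs.lean`). This file transports it to every continuation to `ℂ ∖ {1}`:

* `Literature.NumberTheory.LFunctions.IsDedekindZetaContinuation.sub_one_mul_eqOn` — for *every* continuation `F` of `ζ_K` to
  `ℂ ∖ {1}` and every Landau continuation `G`, `(s − 1) F(s) = G(s)` on the punctured half-plane
  `{σ > 1 − 1/d} ∖ {1}` (identity theorem; the punctured half-plane is connected,
  `isPreconnected_landauHalfPlane_diff_one`, as a chain of four overlapping convex pieces);
* `Literature.NumberTheory.LFunctions.IsDedekindZetaContinuation.ne_zero_of_one_le_re` — hence `F(s) ≠ 0` for `Re s ≥ 1`,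
  `s ≠ 1`, since the zero-free region contains the closed half-plane `σ ≥ 1`
  (`IsLandauContinuation.ne_zero_of_one_le_re`): Landau's property 2), for any continuation;
* `Literature.NumberTheory.LFunctions.IsDedekindZetaContinuation.tendsto_sub_one_mul` — and `(s − 1)F(s) → ρ_K` at `s = 1`
  (`ρ_K = NumberField.dedekindZeta_residue K`), from `G(1) = ρ_K` and continuity of `G` at `1`;
* `Literature.NumberTheory.LFunctions.dedekindZetaCont_ne_zero_of_one_le_re_of_exists`,
  `Literature.NumberTheory.LFunctions.tendsto_sub_one_mul_dedekindZetaCont_of_exists` — the two named facts of `DedekindZeta.lean`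
  from `exists_isDedekindZetaContinuation K` alone; and, feeding in Hecke's theorem,
* `Literature.NumberTheory.LFunctions.dedekindZetaCont_ne_zero_of_one_le_re_holds`, `Literature.NumberTheory.LFunctions.tendsto_sub_one_mul_dedekindZetaCont_holds`
  — the discharges.

This also removes the hypotheses `h₀`, `h₁`, `hz` from the bridge lemmas
`isLandauContinuation_dedekindZetaCont`, `dedekindZetaCont_ne_zero_of_landauContinuation_zeroFree`
of `DedekindZetaHalfPlane.lean` (`Literature.NumberTheory.LFunctions.NumberField.isLandauContinuation_dedekindZetaCont_holds'`,
`Literature.NumberTheory.LFunctions.NumberField.dedekindZetaCont_ne_zero_of_zeroFree`).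

Mathlib has the statement for `K = ℚ` only (`riemannZeta_ne_zero_of_one_le_re`,
`DirichletCharacter.LFunction_ne_zero_of_one_le_re`; grep `ne_zero_of_one_le_re`).

## References

* E. Landau, *Neuer Beweis des Primzahlsatzes und Beweis des Primidealsatzes*, Math. Ann. 56
  (1903), 645–670; Part II, Einleitung, p. 666, properties 1), 2) and (48) p. 665
  (`LandauMathAnn1903`, doi 10.1007/BF01444310; read pp. 665–668).
* H. L. Montgomery, R. C. Vaughan, *Multiplicative Number Theory I*, CUP 2007, p. 267 with
  Theorem 6.6 (`MontgomeryVaughan2007`).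
* J. Neukirch, *Algebraic Number Theory*, Springer 1999, Ch. VII (5.11) Corollary (i) (Hecke's
  continuation) (`NeukirchANT1999`).
-/

noncomputable section

open Complex Filter Set Topology
open scoped NumberField

namespace Literature.NumberTheory.LFunctions

namespace NumberField

variable (K : Type*) [Field K] [NumberField K]

/-! ### The punctured Landau half-plane is connected -/

/-- `1 − 1/d < 1` (`d = [K : ℚ] ≥ 1`): the pole `s = 1` lies in Landau's half-plane. [folklore] -/
theorem one_sub_one_div_finrank_lt_one : 1 - 1 / (Module.finrank ℚ K : ℝ) < 1 := by
  have h := one_le_finrank K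
  have : (0 : ℝ) < 1 / (Module.finrank ℚ K : ℝ) := by positivity
  linarith

/-- The pole `s = 1` lies in Landau's half-plane `σ > 1 − 1/d`. [folklore] -/
theorem one_mem_landauHalfPlane : (1 : ℂ) ∈ landauHalfPlane K := by
  change 1 - 1 / (Module.finrank ℚ K : ℝ) < (1 : ℂ).re
  rw [one_re]
  exact one_sub_one_div_finrank_lt_one K

/-- The closed half-plane `σ ≥ 1` lies in Landau's half-plane `σ > 1 − 1/d`. [folklore] -/
theorem mem_landauHalfPlane_of_one_le_re {s : ℂ} (hs : 1 ≤ s.re) : s ∈ landauHalfPlane K := by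
  change 1 - 1 / (Module.finrank ℚ K : ℝ) < s.re
  exact (one_sub_one_div_finrank_lt_one K).trans_le hs

/-- The punctured Landau half-plane `{σ > 1 − 1/d} ∖ {1}` is the union of the four convex pieces
`{σ > 1}`, `{σ > 1 − 1/d, t > 0}`, `{σ > 1 − 1/d, t < 0}`, `{1 − 1/d < σ < 1}`. [folklore] -/
theorem landauHalfPlane_diff_one_eq_union :
    landauHalfPlane K \ {1} =
      {s : ℂ | 1 < s.re} ∪ (landauHalfPlane K ∩ {s : ℂ | 0 < s.im}) ∪
        (landauHalfPlane K ∩ {s : ℂ | s.im < 0}) ∪ (landauHalfPlane K ∩ {s : ℂ | s.re < 1}) := by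
  have ha1 := one_sub_one_div_finrank_lt_one K
  ext s
  simp only [landauHalfPlane, Set.mem_sdiff, mem_setOf_eq, mem_singleton_iff, mem_union, mem_inter_iff]
  constructor
  · rintro ⟨ha, h1⟩
    rcases lt_trichotomy s.re 1 with h | h | h
    · exact Or.inr ⟨ha, h⟩
    · have him : s.im ≠ 0 := fun him ↦ h1 (Complex.ext (by simpa using h) (by simpa using him))
      rcases him.lt_or_gt with hlt | hgt
      · exact Or.inl (Or.inr ⟨ha, hlt⟩)
      · exact Or.inl (Or.inl (Or.inr ⟨ha, hgt⟩))
    · exact Or.inl (Or.inl (Or.inl h))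
  · rintro (((h | ⟨ha, h⟩) | ⟨ha, h⟩) | ⟨ha, h⟩)
    · exact ⟨by linarith, fun hs ↦ by norm_num [hs] at h⟩
    · exact ⟨ha, fun hs ↦ by norm_num [hs] at h⟩
    · exact ⟨ha, fun hs ↦ by norm_num [hs] at h⟩
    · exact ⟨ha, fun hs ↦ by norm_num [hs] at h⟩

/-- **The punctured Landau half-plane `{σ > 1 − 1/d} ∖ {1}` is (pre)connected**: it is the union
of the four convex pieces of `landauHalfPlane_diff_one_eq_union`, consecutive ones overlapping.
[folklore] -/
theorem isPreconnected_landauHalfPlane_diff_one : IsPreconnected (landauHalfPlane K \ {1}) := by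
  have ha1 := one_sub_one_div_finrank_lt_one K
  rw [landauHalfPlane_diff_one_eq_union]
  have hA : IsPreconnected {s : ℂ | 1 < s.re} := (convex_halfSpace_re_gt 1).isPreconnected
  have hB : IsPreconnected (landauHalfPlane K ∩ {s : ℂ | 0 < s.im}) :=
    ((convex_halfSpace_re_gt _).inter (convex_halfSpace_im_gt 0)).isPreconnected
  have hC : IsPreconnected (landauHalfPlane K ∩ {s : ℂ | s.im < 0}) :=
    ((convex_halfSpace_re_gt _).inter (convex_halfSpace_im_lt 0)).isPreconnected
  have hD : IsPreconnected (landauHalfPlane K ∩ {s : ℂ | s.re < 1}) :=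
    ((convex_halfSpace_re_gt _).inter (convex_halfSpace_re_lt 1)).isPreconnected
  refine ((hA.union' ⟨2 + I, ?_⟩ hB).union' ⟨2 - I, ?_⟩ hC).union'
    ⟨((2 - 1 / (Module.finrank ℚ K : ℝ)) / 2 : ℝ) + I, ?_⟩ hD
  · simp only [landauHalfPlane, mem_inter_iff, mem_setOf_eq, add_re, re_ofNat, I_re, add_zero,
      add_im, im_ofNat, I_im, zero_add]
    exact ⟨by norm_num, by linarith, by norm_num⟩
  · simp only [landauHalfPlane, mem_inter_iff, mem_union, mem_setOf_eq, sub_re, re_ofNat, I_re,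
      sub_zero, sub_im, im_ofNat, I_im, zero_sub]
    exact ⟨Or.inl (by norm_num), by linarith, by norm_num⟩
  · simp only [landauHalfPlane, mem_inter_iff, mem_union, mem_setOf_eq, add_re, ofReal_re, I_re,
      add_zero, add_im, ofReal_im, I_im, zero_add]
    exact ⟨Or.inl (Or.inr ⟨by linarith, by norm_num⟩), by linarith, by linarith⟩

/-- **Landau's property 2) for Landau continuations**: a Landau continuation `G = (s − 1)ζ_K` does
not vanish on the closed half-plane `σ ≥ 1` (which lies inside the zero-free region
`σ > 1 − c_K/log(|t| + 4)` of `landauContinuation_zeroFree_holds`; at `s = 1`, `G(1) = ρ_K ≠ 0` is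
included). (Landau 1903, Part II p. 666, 2).) [cite: LandauMathAnn1903, Part II Einleitung p. 666 property 2] -/
theorem IsLandauContinuation.ne_zero_of_one_le_re {G : ℂ → ℂ} (hG : IsLandauContinuation K G)
    {s : ℂ} (hs : 1 ≤ s.re) : G s ≠ 0 := by
  obtain ⟨c, hc, hzf⟩ := landauContinuation_zeroFree_holds K
  have hlog : 0 < Real.log (|s.im| + 4) := Real.log_pos (by linarith [abs_nonneg s.im])
  have hσ : 1 - c / Real.log (|s.im| + 4) < s.re := by
    have : 0 < c / Real.log (|s.im| + 4) := div_pos hc hlog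
    linarith
  exact hzf G hG s (mem_landauHalfPlane_of_one_le_re K hs) hσ

end NumberField

/-! ### Any continuation of `ζ_K` to `ℂ ∖ {1}` against Landau's continuation -/

variable {K : Type*} [Field K] [NumberField K]

/-- **A continuation of `ζ_K` to `ℂ ∖ {1}` is Landau's on the punctured half-plane.** If `F`
continues `ζ_K` to `ℂ ∖ {1}` (`IsDedekindZetaContinuation K F`) and `G` is a Landau continuation
(`G = (s − 1)ζ_K(s)` on `σ > 1`, holomorphic on `σ > 1 − 1/d`), then `(s − 1)F(s) = G(s)` for all
`s ≠ 1` with `σ > 1 − 1/d`: both sides are holomorphic on the punctured half-plane, which is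
connected (`isPreconnected_landauHalfPlane_diff_one`), and they agree on `σ > 1` (identity theorem,
Mathlib `AnalyticOnNhd.eqOn_of_preconnected_of_eventuallyEq`). [folklore] -/
theorem IsDedekindZetaContinuation.sub_one_mul_eqOn {F G : ℂ → ℂ}
    (hF : IsDedekindZetaContinuation K F) (hG : NumberField.IsLandauContinuation K G) :
    EqOn (fun s ↦ (s - 1) * F s) G (NumberField.landauHalfPlane K \ {1}) := by
  have hUo : IsOpen (NumberField.landauHalfPlane K \ {1}) :=
    (NumberField.isOpen_landauHalfPlane K).sdiff isClosed_singleton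
  have hHd : DifferentiableOn ℂ (fun s ↦ (s - 1) * F s) (NumberField.landauHalfPlane K \ {1}) :=
    (differentiableOn_id.sub (differentiableOn_const _)).mul
      (hF.differentiableOn.mono fun s hs ↦ hs.2)
  have hGd : DifferentiableOn ℂ G (NumberField.landauHalfPlane K \ {1}) :=
    hG.differentiableOn.mono sdiff_subset
  have h2 : (2 : ℂ) ∈ NumberField.landauHalfPlane K \ {1} :=
    ⟨NumberField.mem_landauHalfPlane_of_one_lt_re K (by norm_num), by norm_num⟩
  refine (hHd.analyticOnNhd hUo).eqOn_of_preconnected_of_eventuallyEq (hGd.analyticOnNhd hUo)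
    (NumberField.isPreconnected_landauHalfPlane_diff_one K) h2 ?_
  filter_upwards [(continuous_re.isOpen_preimage _ isOpen_Ioi).mem_nhds
    (show (2 : ℂ) ∈ re ⁻¹' Ioi 1 by norm_num)] with t ht
  have ht' : 1 < t.re := ht
  simp only [hF.eqOn ht', hG.eq_mul t ht']

/-- **Landau's property 2) for every continuation of `ζ_K` to `ℂ ∖ {1}`: no zero with `Re s ≥ 1`,
`s ≠ 1`.** For `s ≠ 1` with `σ ≥ 1` we have `(s − 1)F(s) = G(s)` with `G` the Landau continuation
(`exists_isLandauContinuation_holds`, `sub_one_mul_eqOn`) and `G(s) ≠ 0`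
(`IsLandauContinuation.ne_zero_of_one_le_re`, from the zero-free region
`landauContinuation_zeroFree_holds`). (Landau, Math. Ann. 56 (1903), Part II p. 666, 2): "`ζ_κ(s)`
verschwindet für kein `s` mit dem reellen Teil 1"; (48) p. 665 for `σ > 1`.)
[cite: LandauMathAnn1903, Part II Einleitung p. 666 property 2] -/
theorem IsDedekindZetaContinuation.ne_zero_of_one_le_re {F : ℂ → ℂ}
    (hF : IsDedekindZetaContinuation K F) {s : ℂ} (hs : 1 ≤ s.re) (hs₁ : s ≠ 1) : F s ≠ 0 := by
  obtain ⟨G, hG, -, -⟩ := NumberField.exists_isLandauContinuation_holds K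
  have hGs : G s ≠ 0 := hG.ne_zero_of_one_le_re K hs
  have heq : (s - 1) * F s = G s :=
    hF.sub_one_mul_eqOn hG ⟨NumberField.mem_landauHalfPlane_of_one_le_re K hs, hs₁⟩
  intro hFs
  rw [hFs, mul_zero] at heq
  exact hGs heq.symm

/-- **The residue at `s = 1` for every continuation of `ζ_K` to `ℂ ∖ {1}`**:
`(s − 1)F(s) → ρ_K = 2^{r₁}(2π)^{r₂} h_K R_K / (w_K √|d_K|)` as `s → 1`, `s ≠ 1`
(`NumberField.dedekindZeta_residue K`): near `1`, `(s − 1)F(s) = G(s)` (`sub_one_mul_eqOn`) with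
`G` the Landau continuation, continuous at `1` with `G(1) = ρ_K`
(`exists_isLandauContinuation_holds`; Landau 1903 p. 666 property 1), MV p. 267). [folklore] -/
theorem IsDedekindZetaContinuation.tendsto_sub_one_mul {F : ℂ → ℂ}
    (hF : IsDedekindZetaContinuation K F) :
    Tendsto (fun s : ℂ ↦ (s - 1) * F s) (𝓝[≠] 1)
      (𝓝 (NumberField.dedekindZeta_residue K : ℂ)) := by
  obtain ⟨G, hG, hG1, -⟩ := NumberField.exists_isLandauContinuation_holds K
  have h1L := NumberField.one_mem_landauHalfPlane K
  have hGc : ContinuousAt G 1 :=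
    (hG.differentiableOn.differentiableAt
      ((NumberField.isOpen_landauHalfPlane K).mem_nhds h1L)).continuousAt
  have hGt : Tendsto G (𝓝[≠] 1) (𝓝 (NumberField.dedekindZeta_residue K : ℂ)) := by
    rw [← hG1]
    exact hGc.tendsto.mono_left nhdsWithin_le_nhds
  refine hGt.congr' ?_
  filter_upwards [sdiff_mem_nhdsWithin_compl
    ((NumberField.isOpen_landauHalfPlane K).mem_nhds h1L) {1}] with t ht
  exact (hF.sub_one_mul_eqOn hG ht).symm

/-! ### The named facts of `DedekindZeta.lean` from Hecke's existence theorem alone -/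

variable (K) in
/-- **`dedekindZetaCont_ne_zero_of_one_le_re` from Hecke's existence theorem.** If a
continuation of `ζ_K` to `ℂ ∖ {1}` exists (`exists_isDedekindZetaContinuation K`, Hecke 1917,
Neukirch VII (5.11)(i)), then the chosen continuation `dedekindZetaCont K` is one
(`isDedekindZetaContinuation_dedekindZetaCont_of_exists`), so it has no zero with `Re s ≥ 1`,
`s ≠ 1` (`IsDedekindZetaContinuation.ne_zero_of_one_le_re`; Landau 1903, Part II p. 666, 2)).
[cite: LandauMathAnn1903, Part II Einleitung p. 666 property 2] -/
theorem dedekindZetaCont_ne_zero_of_one_le_re_of_exists (hex : exists_isDedekindZetaContinuation K) :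
    dedekindZetaCont_ne_zero_of_one_le_re (K := K) :=
  fun hs hs₁ ↦
    (isDedekindZetaContinuation_dedekindZetaCont_of_exists K hex).ne_zero_of_one_le_re hs hs₁

variable (K) in
/-- **`tendsto_sub_one_mul_dedekindZetaCont K` from Hecke's existence theorem**: given a
continuation of `ζ_K` to `ℂ ∖ {1}`, `(s − 1) · dedekindZetaCont K s → ρ_K` as `s → 1`, `s ≠ 1`
(`IsDedekindZetaContinuation.tendsto_sub_one_mul`; Landau 1903 p. 666 property 1); Neukirch VII
(5.11)(ii) for the value of the residue, here Mathlib's `NumberField.dedekindZeta_residue`).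
[folklore] -/
theorem tendsto_sub_one_mul_dedekindZetaCont_of_exists (hex : exists_isDedekindZetaContinuation K) :
    tendsto_sub_one_mul_dedekindZetaCont K :=
  (isDedekindZetaContinuation_dedekindZetaCont_of_exists K hex).tendsto_sub_one_mul

/-! ### The discharges (Hecke's existence theorem is `exists_isDedekindZetaContinuation_holds`) -/

variable (K) in
/-- **Landau (1903): the continued Dedekind zeta function has no zero with `Re s ≥ 1`, `s ≠ 1`** —
discharge of the named fact `Literature.NumberTheory.LFunctions.dedekindZetaCont_ne_zero_of_one_le_re` of `DedekindZeta.lean`.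
`dedekindZetaCont K` is a continuation of `ζ_K` to `ℂ ∖ {1}` by Hecke's theorem
(`NumberField.exists_isDedekindZetaContinuation_holds`, Neukirch VII (5.11)(i)), and every such
continuation is zero-free on `σ ≥ 1`, `s ≠ 1` (`IsDedekindZetaContinuation.ne_zero_of_one_le_re`:
identity theorem against Landau's continuation `(s − 1)ζ_K(s)` on `σ > 1 − 1/k` and its
de la Vallée-Poussin zero-free region, `PrimeIdealTheoremProofs.lean`). Source: E. Landau, Math.
Ann. 56 (1903), Zweiter Teil, Einleitung p. 666, property 2) "`ζ_κ(s)` verschwindet für kein `s`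
mit dem reellen Teil 1" (proof: Landau, J. reine angew. Math. 125, p. 82), with the Euler product
(48), p. 665, for `σ > 1`. [cite: LandauMathAnn1903, Part II Einleitung p. 666 property 2] -/
theorem dedekindZetaCont_ne_zero_of_one_le_re_holds : dedekindZetaCont_ne_zero_of_one_le_re (K := K) :=
  dedekindZetaCont_ne_zero_of_one_le_re_of_exists K (NumberField.exists_isDedekindZetaContinuation_holds K)

variable (K) in
/-- **The simple pole of `ζ_K` at `s = 1` with residue `ρ_K`** — discharge of the named fact
`Literature.tendsto_sub_one_mul_dedekindZetaCont K` of `DedekindZeta.lean`: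
`(s − 1) · dedekindZetaCont K s → ρ_K = 2^{r₁}(2π)^{r₂} h_K R_K / (w_K √|d_K|)`
(`NumberField.dedekindZeta_residue K`) as `s → 1`, `s ≠ 1`. From Hecke's existence theorem
(`NumberField.exists_isDedekindZetaContinuation_holds`) and
`IsDedekindZetaContinuation.tendsto_sub_one_mul` (the value `ρ_K` enters through Mathlib's real
one-sided limit `NumberField.tendsto_sub_one_mul_dedekindZeta_nhdsGT`, built into
`IsLandauContinuation`). (Hecke 1917; Neukirch VII (5.11)(ii); Landau 1903 p. 666 property 1).)
[cite: NeukirchANT1999, Ch. VII (5.11) (ii)] -/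
theorem tendsto_sub_one_mul_dedekindZetaCont_holds : tendsto_sub_one_mul_dedekindZetaCont K :=
  tendsto_sub_one_mul_dedekindZetaCont_of_exists K (NumberField.exists_isDedekindZetaContinuation_holds K)

variable (K) in
/-- `(s − 1) · dedekindZetaCont K s`, extended by `ρ_K` at `1`, **is a Landau continuation**,
unconditionally (`DedekindZetaHalfPlane.lean`'s `isLandauContinuation_dedekindZetaCont` with both
hypotheses discharged: `isDedekindZetaContinuation_dedekindZetaCont_holds`,
`tendsto_sub_one_mul_dedekindZetaCont_holds`). [folklore] -/
theorem NumberField.isLandauContinuation_dedekindZetaCont_holds' :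
    NumberField.IsLandauContinuation K
      (Function.update (fun s : ℂ ↦ (s - 1) * dedekindZetaCont K s) 1
        (NumberField.dedekindZeta_residue K : ℂ)) :=
  NumberField.isLandauContinuation_dedekindZetaCont K
    (NumberField.isDedekindZetaContinuation_dedekindZetaCont_holds K)
    (tendsto_sub_one_mul_dedekindZetaCont_holds K)

variable (K) in
/-- **The de la Vallée-Poussin–Landau zero-free region for `dedekindZetaCont K`**, unconditionally:
there is `c > 0` with `dedekindZetaCont K s ≠ 0` for all `s ≠ 1` with `σ > 1 − 1/d` and
`σ > 1 − c/log(|t| + 4)` (`DedekindZetaHalfPlane.lean`'s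
`dedekindZetaCont_ne_zero_of_landauContinuation_zeroFree` with its three hypotheses discharged by
`isDedekindZetaContinuation_dedekindZetaCont_holds`, `tendsto_sub_one_mul_dedekindZetaCont_holds`,
`landauContinuation_zeroFree_holds`; Landau 1903 / Montgomery–Vaughan Thm. 6.6 for `K = ℚ`).
[folklore] -/
theorem NumberField.dedekindZetaCont_ne_zero_of_zeroFree :
    ∃ c : ℝ, 0 < c ∧ ∀ s : ℂ, s ≠ 1 → s ∈ NumberField.landauHalfPlane K →
      1 - c / Real.log (|s.im| + 4) < s.re → dedekindZetaCont K s ≠ 0 :=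
  NumberField.dedekindZetaCont_ne_zero_of_landauContinuation_zeroFree K
    (NumberField.isDedekindZetaContinuation_dedekindZetaCont_holds K)
    (tendsto_sub_one_mul_dedekindZetaCont_holds K)
    (NumberField.landauContinuation_zeroFree_holds K)

end Literature.NumberTheory.LFunctions

end
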